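import Summits.ValiantsHypothesis.ValiantsHypothesis.Theorems.PencilTransfer.Negative.PencilTransferFalseWithoutIsVPFamily
import Literature.Barriers.ValiantsHypothesis.TauRealZeros
import Literature.Computability.AlgebraicComplexity.RealTauConjectureDepthFour

/-!
# `LacunarySymmetroid.PencilTransfer` is false without the DEGREE bound inside `IsVPFamily`

Negative (load-bearing) lemma for the crux `PencilTransfer` (item stmt-ValiantsHypothesis-18051, route
`LacunarySymmetroid`), refining `pencilTransfer_false_without_isVPFamily` (whole hypothesis dropped).
`IsVPFamily g = (IsPBounded #vars ∧ IsPBounded deg) ∧ IsPComputable g`. Keep the variable bound and the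
p-bounded CIRCUIT COMPLEXITY of the complexification, drop only the degree bound: the statement becomes
false. Witness: the Chebyshev tower `f_n = T_{2^n}(x₀)` (one variable, `d_{n,0} = 1`): its
complexification has complexity `≤ τ(T_{2^n}) ≤ 3n` (barrier file `TauRealZeros`:
`constantFreeComplexity_chebyshevT_le`, transported by `complexity_map_le_constantFreeComplexity`), and
its restriction along `x₀ = X` has `2^n` distinct real zeros (`card_realRoots_chebyshevT`), while a
two-term pencil of size `m` has at most `m ≤ 2^((log₂ n + c)^c)` (`card_roots_toFinset_twoTermPencil_le`);
at `n = 2^t` with `(t + c)^c < 2^t` this is `< 2^n`. So the wall's own witness (TauRealZeros) enters the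
crux exactly through the p-family DEGREE clause: any proof of `PencilTransfer` must use `IsPBounded deg`
(it is what makes `dc` quasi-polynomial), whereas the `#vars` clause is never used
(`isQPBounded_determinantalComplexity_of_isVPFamily_holds` discards it).
-/

-- `Summit.ValiantsHypothesis.ValiantsHypothesis.…` is the tree's mandated single-conjunct layout
-- (Sub = Summit), so the duplicated namespace component is intended.
set_option linter.dupNamespace false

namespace Summit.ValiantsHypothesis.ValiantsHypothesis.Theorems.PencilTransfer.Negative

open Polynomial Literature.Computability.AlgebraicComplexity Literature.Barriers.ValiantsHypothesis

/-! The witness family is the real Chebyshev tower `T_{2^n}(x₀) ∈ ℝ[x₀]`, rendered as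
`MvPolynomial.map (Int.castRingHom ℝ) (chebyshevT n) : MvPolynomial (Fin 1) ℝ` (the integer tower
`chebyshevT` of the barrier file `TauRealZeros`, base-changed to `ℝ`; kept inline, no new definition). -/

/-- The complexification of the real tower is the integer tower base-changed to `ℂ`. [folklore] -/
theorem map_chebFamily (n : ℕ) :
    MvPolynomial.map (algebraMap ℝ ℂ) (MvPolynomial.map (Int.castRingHom ℝ) (chebyshevT n)) =
      MvPolynomial.map (Int.castRingHom ℂ) (chebyshevT n) := by
  rw [MvPolynomial.map_map]
  congr 1

/-- `L_ℂ(T_{2^n}) ≤ τ(T_{2^n}) ≤ 3n`. [cite: Koiran2011, §1 (p. 3)] -/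
theorem complexity_map_chebFamily_le (n : ℕ) :
    complexity (MvPolynomial.map (algebraMap ℝ ℂ) (MvPolynomial.map (Int.castRingHom ℝ) (chebyshevT n))) ≤ 3 * n := by
  rw [map_chebFamily]
  exact (ArithCircuit.complexity_map_le_constantFreeComplexity _ _).trans
    (constantFreeComplexity_chebyshevT_le n)

/-- The complexified Chebyshev tower is p-computable (`3n ≤ n² + 2`). [cite: Koiran2011, §1 (p. 3)] -/
theorem isPComputable_chebFamily :
    IsPComputable (fun n => MvPolynomial.map (algebraMap ℝ ℂ) (MvPolynomial.map (Int.castRingHom ℝ) (chebyshevT n))) := by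
  refine ⟨2, fun n => (complexity_map_chebFamily_le n).trans ?_⟩
  rcases n with _ | _ | n
  · simp
  · norm_num
  · nlinarith [Nat.zero_le n]

/-- The restriction of the real tower along `x₀ = X¹` is the real Chebyshev polynomial `T_{2^n}`
(both sides are the image of `T_{2^n} ∈ ℤ[X]` under ring maps `ℤ[X] → ℝ[X]` sending `X ↦ X`). [folklore] -/
theorem aeval_chebFamily (n : ℕ) :
    MvPolynomial.aeval (fun _ : Fin 1 => (X : ℝ[X]) ^ 1)
      (MvPolynomial.map (Int.castRingHom ℝ) (chebyshevT n)) =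
      (Chebyshev.T ℤ ((2 ^ n : ℕ) : ℤ)).map (Int.castRingHom ℝ) := by
  have key : ((MvPolynomial.aeval (fun _ : Fin 1 => (X : ℝ[X]) ^ 1)).toRingHom.comp
      ((MvPolynomial.map (Int.castRingHom ℝ)).comp
        (MvPolynomial.uniqueAlgEquiv ℤ (Fin 1)).symm.toAlgHom.toRingHom)) =
      Polynomial.mapRingHom (Int.castRingHom ℝ) := by
    apply Polynomial.ringHom_ext'
    · exact RingHom.ext_int _ _
    · simp [MvPolynomial.uniqueAlgEquiv_symm_apply]
  have h := RingHom.congr_fun key (Chebyshev.T ℤ ((2 ^ n : ℕ) : ℤ))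
  simpa [chebyshevT] using h

/-- `T_{2^n}(X)` restricted along `x₀ = X` has exactly `2^n` distinct real zeros. [cite: Koiran2011, §1 (p. 3)] -/
theorem card_roots_toFinset_aeval_chebFamily (n : ℕ) :
    (MvPolynomial.aeval (fun _ : Fin 1 => (X : ℝ[X]) ^ 1)
      (MvPolynomial.map (Int.castRingHom ℝ) (chebyshevT n))).roots.toFinset.card =
      2 ^ n := by
  rw [aeval_chebFamily, card_realRoots_chebyshevT]

/-- Growth bookkeeping: for every `c` some `t ≥ 1` has `(t + c)^c < 2^t`. [folklore] -/
theorem exists_add_pow_lt_two_pow (c : ℕ) : ∃ t : ℕ, 1 ≤ t ∧ (t + c) ^ c < 2 ^ t := by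
  obtain ⟨T₀, hT⟩ := eventually_mul_pow_lt_two_pow c ((c + 1) ^ c)
  refine ⟨max T₀ 1, le_max_right _ _, ?_⟩
  set t : ℕ := max T₀ 1 with ht
  have ht1 : 1 ≤ t := le_max_right _ _
  calc (t + c) ^ c ≤ ((c + 1) * t) ^ c := Nat.pow_le_pow_left (by nlinarith) c
    _ = (c + 1) ^ c * t ^ c := by rw [mul_pow]
    _ < 2 ^ t := hT t (le_max_left _ _)

/-- **The degree clause of `IsVPFamily` is load-bearing for `PencilTransfer`**: with it dropped (the hypothesis
weakened to: p-bounded variable count and p-computable complexification; conclusion verbatim that of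
`LacunarySymmetroid.PencilTransfer`) the statement is false — witness the Chebyshev tower `T_{2^n}(x₀)` along
`x₀ = X`: `2^n` distinct real zeros at complexity `≤ 3n`, versus `≤ m ≤ 2^((log₂ n + c)^c) < 2^n` for any
two-term pencil at `n = 2^t`, `(t + c)^c < 2^t`. This is the `TauRealZeros` wall re-entering the crux
through the one clause (p-bounded degree) that keeps it out. [cite: Koiran2011, §1 (p. 3)] -/
theorem pencilTransfer_false_without_degreeBound :
    ¬ (∀ (v : ℕ → ℕ) (f : ∀ n, MvPolynomial (Fin (v n)) ℝ),
        IsPBounded (fun n => Fintype.card (Fin (v n))) →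
        IsPComputable (fun n => MvPolynomial.map (algebraMap ℝ ℂ) (f n)) →
        ∀ d : (n : ℕ) → Fin (v n) → ℕ, ∃ c : ℕ, ∀ n : ℕ, ∃ m : ℕ, m ≤ 2 ^ ((Nat.log 2 n + c) ^ c) ∧
          ∃ S : Fin (v n + 1) → Matrix (Fin m) (Fin m) ℝ, (∀ l, (S l).IsSymm) ∧
            (Matrix.det (∑ l, ((Polynomial.X : Polynomial ℝ) ^
                (Fin.cons (α := fun _ => ℕ) (0 : ℕ) (d n) l)) • (S l).map Polynomial.C)).roots.toFinset =
            (MvPolynomial.aeval (fun i => (Polynomial.X : Polynomial ℝ) ^ d n i) (f n)).roots.toFinset) := by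
  intro h
  obtain ⟨c, hc⟩ := h (fun _ => 1) (fun n => MvPolynomial.map (Int.castRingHom ℝ) (chebyshevT n))
    ⟨1, fun n => by simp⟩ isPComputable_chebFamily (fun _ _ => 1)
  obtain ⟨t, -, hlt⟩ := exists_add_pow_lt_two_pow c
  obtain ⟨m, hm, S, -, hroots⟩ := hc (2 ^ t)
  have hR := card_roots_toFinset_aeval_chebFamily (2 ^ t)
  rw [← hroots] at hR
  have hle :=
    Summit.ValiantsHypothesis.Theorems.PencilTransfer.Negative.card_roots_toFinset_twoTermPencil_le m S
  rw [hR] at hle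
  rw [Nat.log_pow (by norm_num : 1 < 2)] at hm
  have h2 : 2 ^ ((t + c) ^ c) < 2 ^ (2 ^ t) := Nat.pow_lt_pow_right (by norm_num) hlt
  omega

end Summit.ValiantsHypothesis.ValiantsHypothesis.Theorems.PencilTransfer.Negative
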